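/-
Copyright (c) 2026. All rights reserved.
Released under Apache 2.0 license as described in the file LICENSE.
-/
import Literature.NumberTheory.Automorphic.BrandtModuleSignPatternDecomposition
import Literature.NumberTheory.Automorphic.EichlerOrdersAtkinLehnerGroup
import Mathlib.GroupTheory.NoncommPiCoprod
import Mathlib.GroupTheory.GroupAction.Quotient
import HarnessLib

/-!
# Martin's quaternionic `S`-ideal classes `Cl_S(O)`: the orbits of the local Atkin–Lehner involutions, the
# `S`-ideal class numbers `h_{B,S} = dim M^{+_S}(O)`, `Cl_∅(O) = Cls O`, `Cl_𝔑(O) = Typ O`, class sizes `2^m`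
# (Martin 2018, §2, (3.8)–(3.9), Lemma 9)

[tag: quaternion_algebra] [tag: eichler_order] [tag: class_number]

Topic `NumberTheory/Automorphic`. Lane `lit-hodgefound`, seat p12, gen 52 — sequel of
`BrandtModuleSignPatternDecomposition.lean` (the local involutions `W_r = XiSetup.atkinLehner r` of `Cls O` and the sign
spaces `M^χ(O)`) and of `EichlerOrdersAtkinLehnerGroup.lean` (the Atkin–Lehner group at ALL the primes of `N⁺N⁻`, whose
orbits are the fibres of the type map).

Let `O` be an Eichler order of level `N⁺` in the definite quaternion algebra `B` of discriminant `N⁻` over `ℚ` (a Brandt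
setup `S : XiSetup N⁺ N⁻`) and `T` a finite set of natural numbers (Martin's set `S` of primes `𝔭 ∣ 𝔑`; at `r ∉` primes of
`N⁺N⁻` the involution `W_r` is the identity). [Martin2018, §2]: "we define the (right) `S`-ideal classes of `O` to be
`Cl_S(O) := B^× \ B̂^× / Ô_S^×`, `Ô_S^× = ∏_{𝔭 ∈ S} B_𝔭^× × ∏_{𝔭 ∉ S} O_𝔭^×` … if `S = ∅` one gets `Cl(O)`, and if
`S = {𝔭 : 𝔭 ∣ 𝔑}` one gets [the conjugacy classes of maximal orders] … Denote the `S`-ideal class number `|Cl_S(O)|` by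
`h_{B,S}`"; [Martin2018, §4.1]: "the associated `{𝔭}`-ideal class `[x]_𝔭` is either `[x]` or `[x] ⊔ [x ϖ_{B_𝔭}]` … the
orbits of this involution are precisely the fibers of `Cl(O) → Cl_𝔭(O)`"; [Martin2018, §4.4]: "`x_j` lies in the connected
component of `x_i` if and only if it lies in the orbit of `x_i` under the permutation group generated by `{σ_𝔭 : 𝔭 ∣ 𝔐}` …
this is equivalent to `x_j` lying in the same `S`-ideal class as `x_i`". Accordingly (DEFINITIONS, §2):

* `XiSetup.sClassSetoid T` — `c ∼_T c'` iff `c'` is reached from `c` by the involutions `W_r`, `r ∈ T`;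
* `XiSetup.SClassSet T = Cl_T(O)` — the quotient, Martin's `T`-ideal classes; `XiSetup.sClassOf T : Cls O → Cl_T(O)`;
* `XiSetup.atkinLehnerHom T : (ℤ/2ℤ)^T → Sym(Cls O)` — the sign group acting by `g ↦ ∏_{r ∈ T} W_r^{g_r}` (§1).

Main results (every Brandt setup, every `T`):

* §1 `atkinLehnerHom_mulSingle` (`Φ_T(e_r) = W_r`), `atkinLehnerHom_mul_self` (`Φ_T(g)² = 1`), `typeOf_atkinLehnerHom`,
  `matrix_apply_atkinLehnerHom_atkinLehnerHom`;
* §2 `sClassSetoid_iff_exists_atkinLehnerHom` (**the `T`-classes are the orbits of `(ℤ/2ℤ)^T`**), `sClassOf_atkinLehner`,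
  `sClassOf_surjective`, `finite_sClassSet`, `typeOf_eq_of_sClassOf_eq` (the type map factors through `Cl_T(O)`),
  **`natCard_typeSet_le_natCard_sClassSet`** and **`natCard_sClassSet_le_natCard_classSet`** (`t ≤ h_T ≤ h`);
* §3 **`sClassOf_injective_of_forall_not_mem`** / **`natCard_sClassSet_eq_natCard_classSet`** (`T` without primes of
  `N⁺N⁻`, e.g. `T = ∅`: `Cl_T(O) = Cls O`, [Martin2018, §2]) and **`sClassSetoid_iff_typeOf_eq`** /
  **`natCard_sClassSet_eq_natCard_typeSet`** (`T ⊇` primes of `N⁺N⁻`: `Cl_T(O) = Typ O`, [Martin2018, §2]);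
* §4 **`mem_signSpace_one_iff_exists_comp_sClassOf`** and **`signSpace_one_eq_range_funLeft_sClassOf`** (Martin (3.8):
  `M_0^{+_𝔐}(O) ≃ {φ : Cl_𝔐(O) → ℂ}`), ★ **`finrank_signSpace_one_eq_natCard_sClassSet`** (Martin (3.9):
  `h_{B,𝔐} = dim M_0^{+_𝔐}(O)`), `mapsTo_toLin_matrix_range_funLeft_sClassOf` (a Hecke submodule);
* §5 `sClassSetoid_mono` / `natCard_sClassSet_anti` (`T ⊆ T' ⇒ h_{T'} ≤ h_T`), **`sClassSetoid_atkinLehner`** (Martin's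
  Lemma 9: `W_r` maps `T`-classes onto `T`-classes), **`sClassSetoid_insert_iff`** (a `T ∪ {r}`-class is a `T`-class or
  the union of a `T`-class and its `W_r`-image: "fibers of size 1 or 2"), **`natCard_sClassSet_le_two_mul_natCard_sClassSet_insert`**
  (`h_T ≤ 2 h_{T ∪ {r}}`);
* §6 orbit–stabiliser and Burnside: **`natCard_sClass_mul_natCard_stabilizer`** (`#X_i · #Stab = 2^{#T}`),
  ★ **`exists_natCard_sClass_eq_two_pow`** ("each connected component `X_i` has cardinality `2^m`", with `m ≤ #T`),
  `natCard_sClass_le_two_pow`, **`natCard_classSet_le_two_pow_mul_natCard_sClassSet`** (`h ≤ 2^{#T} h_T`),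
  **`sum_natCard_fixedPoints_atkinLehnerHom`** (Burnside: `∑_{g ∈ (ℤ/2ℤ)^T} #Fix(Φ_T g) = 2^{#T} h_T`).

## References

* [Martin2018] K. Martin, *Congruences for modular forms mod 2 and quaternionic `S`-ideal classes*, Canad. J. Math. 70
  (2018) 1076–1095 (held: arXiv 1701.07864): §2, §3.3 (3.8)–(3.9), §4.1, §4.4 (the graph `Σ_χ`, Lemma 9 and the remark
  after it).
* [Voight2021] J. Voight, *Quaternion Algebras*, GTM 288 (2021): Prop. 18.5.10, Cor. 18.5.12, (23.4.20).
* [VignerasLNM800] M.-F. Vignéras, *Arithmétique des algèbres de quaternions*, LNM 800 (1980), Ch. III §5 exercice 5.8.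

## Scope (honest)

Martin: maximal orders over totally real `F` with `h_F⁺ = 1`, `S` a set of ramified primes, adelic double cosets; here
`F = ℚ`, Eichler level `N⁺` with the level involutions `W_{p⁺}` admitted into `T`, and `Cl_T(O)` is DEFINED as the orbit
space of the involutions (Martin's description in §4.1/§4.4 of the fibres of `Cl(O) → Cl_S(O)`), not as a double coset.
Martin's remark after Lemma 9 prints the bound `m ≤ 2^{ω(𝔐)}`; the orbit–stabiliser proof here gives `m ≤ ω(𝔐) = #T`.
Four definitions, theorems otherwise; no named fact, no instance.
-/

noncomputable section

open scoped Pointwise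

namespace Literature.NumberTheory.Automorphic

namespace Brandt

/-! ## §0 Generic: words in commuting involutions (private) -/

section Generic

variable {X ι : Type*}

/-- The two elements of `ℤ/2ℤ` (multiplicative notation). [folklore] -/
private theorem eq_one_or_eq_ofAdd_one' (z : Multiplicative (ZMod 2)) : z = 1 ∨ z = Multiplicative.ofAdd 1 := by
  revert z; decide

/-- Every `Φ(g) x` is reachable from `x` by the generators `W_i`. [folklore] -/
private theorem reflTransGen_hom_apply' [Fintype ι] [DecidableEq ι] (W : ι → Equiv.Perm X)
    (Φ : (ι → Multiplicative (ZMod 2)) →* Equiv.Perm X) (hΦ : ∀ i, Φ (Pi.mulSingle i (Multiplicative.ofAdd 1)) = W i)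
    (g : ι → Multiplicative (ZMod 2)) (x : X) :
    Relation.ReflTransGen (fun a b => ∃ i, W i a = b) x (Φ g x) := by
  suffices key : ∀ s : Finset ι,
      Relation.ReflTransGen (fun a b => ∃ i, W i a = b) x (Φ (∏ i ∈ s, Pi.mulSingle i (g i)) x) by
    have := key Finset.univ
    rwa [Finset.univ_prod_mulSingle] at this
  intro s
  induction s using Finset.induction_on with
  | empty =>
    rw [show Φ (∏ i ∈ (∅ : Finset ι), Pi.mulSingle i (g i)) x = x by
      rw [Finset.prod_empty, map_one, Equiv.Perm.coe_one, id_eq]]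
  | @insert j s hj ih =>
    rw [Finset.prod_insert hj, map_mul, Equiv.Perm.coe_mul, Function.comp_apply]
    rcases eq_one_or_eq_ofAdd_one' (g j) with h | h
    · rw [h, Pi.mulSingle_one, map_one, Equiv.Perm.coe_one, id_eq]; exact ih
    · rw [h, hΦ]
      exact ih.tail ⟨j, rfl⟩

/-- Conversely, a point reachable from `x` by the `W_i` is some `Φ(g) x`. [folklore] -/
private theorem exists_hom_apply_eq_of_reflTransGen' [Fintype ι] [DecidableEq ι] (W : ι → Equiv.Perm X)
    (Φ : (ι → Multiplicative (ZMod 2)) →* Equiv.Perm X) (hΦ : ∀ i, Φ (Pi.mulSingle i (Multiplicative.ofAdd 1)) = W i)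
    {x y : X} (h : Relation.ReflTransGen (fun a b => ∃ i, W i a = b) x y) :
    ∃ g : ι → Multiplicative (ZMod 2), Φ g x = y := by
  induction h with
  | refl => exact ⟨1, by rw [map_one, Equiv.Perm.coe_one, id_eq]⟩
  | tail _ hbc ih =>
    obtain ⟨g, rfl⟩ := ih
    obtain ⟨i, rfl⟩ := hbc
    exact ⟨Pi.mulSingle i (Multiplicative.ofAdd 1) * g, by rw [map_mul, Equiv.Perm.coe_mul, Function.comp_apply, hΦ]⟩

/-- A symmetric one-step relation has a symmetric reflexive-transitive closure. [folklore] -/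
private theorem reflTransGen_symm_of_symm {ρ : X → X → Prop} (hρ : ∀ a b, ρ a b → ρ b a) {a b : X}
    (h : Relation.ReflTransGen ρ a b) : Relation.ReflTransGen ρ b a := by
  induction h with
  | refl => exact Relation.ReflTransGen.refl
  | tail _ hbc ih => exact Relation.ReflTransGen.head (hρ _ _ hbc) ih

end Generic

variable {Nplus Nminus : ℕ} (S : XiSetup Nplus Nminus)

/-! ## §1 The sign group `(ℤ/2ℤ)^T` acting on `Cls O` through the local involutions -/

/-- `W_r^{k mod 2} = W_r^k` for an involution. [folklore] -/
private theorem toPerm_atkinLehner_pow_mod_two (r : ℕ) (k : ℕ) :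
    ((S.involutive_atkinLehner r).toPerm _) ^ (k % 2) = ((S.involutive_atkinLehner r).toPerm _) ^ k := by
  have h2 : ((S.involutive_atkinLehner r).toPerm _) ^ 2 = 1 := by
    ext c
    rw [sq, Equiv.Perm.coe_mul, Function.comp_apply, Function.Involutive.coe_toPerm, Equiv.Perm.coe_one, id_eq]
    exact S.atkinLehner_atkinLehner r c
  conv_rhs => rw [← Nat.mod_add_div k 2, pow_add, pow_mul, h2, one_pow, mul_one]

/-- `z ↦ W_r^z` (`z ∈ ℤ/2ℤ`): the order-two group generated by one local involution. [cite: Martin2018, §4.1 ("a permutation of order 2")] -/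
def XiSetup.atkinLehnerPowHom (r : ℕ) : Multiplicative (ZMod 2) →* Equiv.Perm (ClassSet S.O) where
  toFun z := ((S.involutive_atkinLehner r).toPerm _) ^ (Multiplicative.toAdd z).val
  map_one' := by rw [toAdd_one, ZMod.val_zero, pow_zero]
  map_mul' a b := by rw [toAdd_mul, ZMod.val_add, toPerm_atkinLehner_pow_mod_two S, pow_add]

/-- Unfolding `atkinLehnerPowHom`. [cite: Martin2018, §4.1] -/
theorem XiSetup.atkinLehnerPowHom_apply (r : ℕ) (z : Multiplicative (ZMod 2)) :
    S.atkinLehnerPowHom r z = ((S.involutive_atkinLehner r).toPerm _) ^ (Multiplicative.toAdd z).val :=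
  rfl

/-- `atkinLehnerPowHom r (1 mod 2) = W_r`. [cite: Martin2018, §4.1] -/
theorem XiSetup.atkinLehnerPowHom_ofAdd_one (r : ℕ) (c : ClassSet S.O) :
    S.atkinLehnerPowHom r (Multiplicative.ofAdd 1) c = S.atkinLehner r c := by
  rw [S.atkinLehnerPowHom_apply, toAdd_ofAdd, ZMod.val_one, pow_one, Function.Involutive.coe_toPerm]

/-- The one-prime subgroups commute with each other. [cite: Martin2018, §4.4] -/
theorem XiSetup.commute_atkinLehnerPowHom (r r' : ℕ) (a b : Multiplicative (ZMod 2)) :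
    Commute (S.atkinLehnerPowHom r a) (S.atkinLehnerPowHom r' b) := by
  rw [S.atkinLehnerPowHom_apply, S.atkinLehnerPowHom_apply]
  refine Commute.pow_pow ?_ _ _
  ext c
  rw [Equiv.Perm.coe_mul, Function.comp_apply, Equiv.Perm.coe_mul, Function.comp_apply,
    Function.Involutive.coe_toPerm, Function.Involutive.coe_toPerm]
  exact S.atkinLehner_comm r r' c

/-- **The Atkin–Lehner sign group `(ℤ/2ℤ)^T` acting on `Cls O`**: the homomorphism `Φ_T : (ℤ/2ℤ)^T → Sym(Cls O)`,
`g ↦ ∏_{r ∈ T} W_r^{g_r}` ("the permutation group generated by `{σ_𝔭 : 𝔭 ∣ 𝔐}`"; Voight: `Idl(O)/PIdl` is an elementary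
abelian `2`-group acting on the classes). [cite: Martin2018, §4.4] [cite: Voight2021, Prop. 18.5.10 and (23.4.20)] -/
def XiSetup.atkinLehnerHom (T : Finset ℕ) : (T → Multiplicative (ZMod 2)) →* Equiv.Perm (ClassSet S.O) :=
  MonoidHom.noncommPiCoprod (fun r : T => S.atkinLehnerPowHom r)
    fun r r' _ a b => S.commute_atkinLehnerPowHom r r' a b

variable (T : Finset ℕ)

/-- **`Φ_T(e_r) = W_r`** for the basis vector `e_r`, `r ∈ T`. [cite: Martin2018, §4.4] -/
theorem XiSetup.atkinLehnerHom_mulSingle (r : T) (c : ClassSet S.O) :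
    S.atkinLehnerHom T (Pi.mulSingle r (Multiplicative.ofAdd 1)) c = S.atkinLehner r c := by
  classical
  rw [XiSetup.atkinLehnerHom, MonoidHom.noncommPiCoprod_mulSingle, S.atkinLehnerPowHom_ofAdd_one]

/-- `Φ_T(e_r)` is the permutation `W_r`. [cite: Martin2018, §4.4] -/
theorem XiSetup.atkinLehnerHom_mulSingle_eq_toPerm (r : T) :
    S.atkinLehnerHom T (Pi.mulSingle r (Multiplicative.ofAdd 1)) = (S.involutive_atkinLehner r).toPerm _ := by
  classical
  ext c
  rw [S.atkinLehnerHom_mulSingle, Function.Involutive.coe_toPerm]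

/-- **Every `Φ_T(g) c` is reached from `c` by steps `W_r`, `r ∈ T`, and conversely.** [cite: Martin2018, §4.4] -/
theorem XiSetup.reflTransGen_iff_exists_atkinLehnerHom (c c' : ClassSet S.O) :
    Relation.ReflTransGen (fun a b => ∃ r : T, S.atkinLehner r a = b) c c' ↔ ∃ g, S.atkinLehnerHom T g c = c' := by
  classical
  have hΦ : ∀ r : T, S.atkinLehnerHom T (Pi.mulSingle r (Multiplicative.ofAdd 1)) = (S.involutive_atkinLehner r).toPerm _ :=
    S.atkinLehnerHom_mulSingle_eq_toPerm T
  have hmono₁ : ∀ a b, (∃ r : T, S.atkinLehner r a = b) → ∃ r : T, (S.involutive_atkinLehner r).toPerm _ a = b :=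
    fun a b hab => by
      obtain ⟨r, hr⟩ := hab
      exact ⟨r, by rw [Function.Involutive.coe_toPerm]; exact hr⟩
  have hmono₂ : ∀ a b, (∃ r : T, (S.involutive_atkinLehner r).toPerm _ a = b) → ∃ r : T, S.atkinLehner r a = b :=
    fun a b hab => by
      obtain ⟨r, hr⟩ := hab
      exact ⟨r, by rw [Function.Involutive.coe_toPerm] at hr; exact hr⟩
  constructor
  · intro h
    have h' : Relation.ReflTransGen (fun a b => ∃ r : T, (S.involutive_atkinLehner r).toPerm _ a = b) c c' :=
      Relation.ReflTransGen.mono hmono₁ _ _ h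
    exact exists_hom_apply_eq_of_reflTransGen' _ (S.atkinLehnerHom T) hΦ h'
  · rintro ⟨g, rfl⟩
    exact Relation.ReflTransGen.mono hmono₂ _ _ (reflTransGen_hom_apply' _ (S.atkinLehnerHom T) hΦ g c)

/-- **`Φ_T(g)² = 1`**: the sign group acts through an elementary abelian `2`-group. [cite: Martin2018, §4.4] [cite: Voight2021, Prop. 18.5.10] -/
theorem XiSetup.atkinLehnerHom_mul_self (g : T → Multiplicative (ZMod 2)) :
    S.atkinLehnerHom T g * S.atkinLehnerHom T g = 1 := by
  rw [← map_mul, ← map_one (S.atkinLehnerHom T)]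
  congr 1
  funext r
  have key : ∀ z : Multiplicative (ZMod 2), z * z = 1 := by decide
  exact key (g r)

/-- `Φ_T(g) (Φ_T(g) c) = c`. [cite: Martin2018, §4.4] -/
theorem XiSetup.atkinLehnerHom_atkinLehnerHom (g : T → Multiplicative (ZMod 2)) (c : ClassSet S.O) :
    S.atkinLehnerHom T g (S.atkinLehnerHom T g c) = c := by
  have h := congrArg (fun σ : Equiv.Perm (ClassSet S.O) => σ c) (S.atkinLehnerHom_mul_self T g)
  simpa only [Equiv.Perm.coe_mul, Function.comp_apply, Equiv.Perm.coe_one, id_eq] using h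

/-- `Φ_T(g)` preserves the type (each `W_r` does). [cite: Martin2018, §4.1 Lemma 4] -/
theorem XiSetup.typeOf_atkinLehnerHom (g : T → Multiplicative (ZMod 2)) (c : ClassSet S.O) :
    typeOf S.O (S.atkinLehnerHom T g c) = typeOf S.O c := by
  have key : ∀ c', Relation.ReflTransGen (fun a b => ∃ r : T, S.atkinLehner r a = b) c c' →
      typeOf S.O c' = typeOf S.O c := by
    intro c' h
    induction h with
    | refl => rfl
    | tail _ hbc ih =>
      obtain ⟨r, rfl⟩ := hbc
      rw [S.typeOf_atkinLehner, ih]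
  exact key _ ((S.reflTransGen_iff_exists_atkinLehnerHom T c (S.atkinLehnerHom T g c)).mpr ⟨g, rfl⟩)

/-- `T(n)_{Φ c, Φ c'} = T(n)_{c c'}` for every `g` and every `n`. [cite: Voight2021, (41.3.5)] -/
theorem XiSetup.matrix_apply_atkinLehnerHom_atkinLehnerHom (g : T → Multiplicative (ZMod 2)) (n : ℕ) (c c' : ClassSet S.O) :
    matrix S.O n (S.atkinLehnerHom T g c) (S.atkinLehnerHom T g c') = matrix S.O n c c' := by
  classical
  -- induct over the support of `g`
  suffices key : ∀ (s : Finset T) (c c' : ClassSet S.O),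
      matrix S.O n (S.atkinLehnerHom T (∏ i ∈ s, Pi.mulSingle i (g i)) c)
        (S.atkinLehnerHom T (∏ i ∈ s, Pi.mulSingle i (g i)) c') = matrix S.O n c c' by
    have := key Finset.univ c c'
    rwa [Finset.univ_prod_mulSingle] at this
  intro s
  induction s using Finset.induction_on with
  | empty => intro c c'; rw [Finset.prod_empty, map_one, Equiv.Perm.coe_one, id_eq, id_eq]
  | @insert j s hj ih =>
    intro c c'
    rw [Finset.prod_insert hj, map_mul, Equiv.Perm.coe_mul, Function.comp_apply, Function.comp_apply]
    rcases eq_one_or_eq_ofAdd_one' (g j) with h | h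
    · rw [h, Pi.mulSingle_one, map_one, Equiv.Perm.coe_one, id_eq, id_eq]; exact ih c c'
    · rw [h, S.atkinLehnerHom_mulSingle, S.atkinLehnerHom_mulSingle, S.matrix_apply_atkinLehner_atkinLehner]
      exact ih c c'

/-! ## §2 The `T`-ideal classes `Cl_T(O)` -/

/-- **Martin's `T`-ideal class relation on `Cls O`**: `c ∼_T c'` iff `c'` is reached from `c` by the local involutions
`W_r`, `r ∈ T` ("`x_j` lies in the same `S`-ideal class as `x_i`" iff "it lies in the orbit of `x_i` under the permutation
group generated by `{σ_𝔭 : 𝔭 ∣ 𝔐}`"). [cite: Martin2018, §2 and §4.4] -/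
def XiSetup.sClassSetoid (T : Finset ℕ) : Setoid (ClassSet S.O) where
  r c c' := Relation.ReflTransGen (fun a b => ∃ r : T, S.atkinLehner r a = b) c c'
  iseqv :=
    ⟨fun _ => Relation.ReflTransGen.refl,
      fun h => reflTransGen_symm_of_symm
        (fun a b ⟨r, hr⟩ => ⟨r, by rw [← hr, S.atkinLehner_atkinLehner]⟩) h,
      fun h₁ h₂ => h₁.trans h₂⟩

/-- **Martin's set of `T`-ideal classes `Cl_T(O)`** of the Eichler order (`T`-classes of right ideal classes).
[cite: Martin2018, §2 (`Cl_S(O)`, `h_{B,S}`)] -/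
def XiSetup.SClassSet (T : Finset ℕ) : Type := Quotient (S.sClassSetoid T)

/-- **The projection `Cls O → Cl_T(O)`** (Martin's `[x] ↦ [x]_S`). [cite: Martin2018, §2 and §4.1 (4.1)] -/
def XiSetup.sClassOf (T : Finset ℕ) : ClassSet S.O → S.SClassSet T := Quotient.mk (S.sClassSetoid T)

/-- Unfolding the relation. [cite: Martin2018, §4.4] -/
theorem XiSetup.sClassSetoid_iff (c c' : ClassSet S.O) :
    S.sClassSetoid T c c' ↔ Relation.ReflTransGen (fun a b => ∃ r : T, S.atkinLehner r a = b) c c' :=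
  Iff.rfl

/-- **The `T`-classes are the orbits of the sign group `(ℤ/2ℤ)^T`.** [cite: Martin2018, §4.4] [cite: Voight2021, Prop. 18.5.10] -/
theorem XiSetup.sClassSetoid_iff_exists_atkinLehnerHom (c c' : ClassSet S.O) :
    S.sClassSetoid T c c' ↔ ∃ g, S.atkinLehnerHom T g c = c' :=
  S.reflTransGen_iff_exists_atkinLehnerHom T c c'

/-- `sClassOf c = sClassOf c'` iff `c ∼_T c'`. [cite: Martin2018, §2] -/
theorem XiSetup.sClassOf_eq_sClassOf_iff (c c' : ClassSet S.O) :
    S.sClassOf T c = S.sClassOf T c' ↔ S.sClassSetoid T c c' :=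
  Quotient.eq (r := S.sClassSetoid T)

/-- `sClassOf c = sClassOf c'` iff `c' = Φ_T(g) c` for some `g`. [cite: Martin2018, §4.4] -/
theorem XiSetup.sClassOf_eq_sClassOf_iff_exists_atkinLehnerHom (c c' : ClassSet S.O) :
    S.sClassOf T c = S.sClassOf T c' ↔ ∃ g, S.atkinLehnerHom T g c = c' := by
  rw [S.sClassOf_eq_sClassOf_iff, S.sClassSetoid_iff_exists_atkinLehnerHom]

/-- The projection is onto. [cite: Martin2018, §4.1 ("a surjective map")] -/
theorem XiSetup.sClassOf_surjective : Function.Surjective (S.sClassOf T) :=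
  Quotient.mk_surjective

/-- **`[W_r c]_T = [c]_T` for `r ∈ T`** (the orbits of `σ_𝔭` are the fibres of `Cl(O) → Cl_𝔭(O)`). [cite: Martin2018, §4.1] -/
theorem XiSetup.sClassOf_atkinLehner (r : T) (c : ClassSet S.O) : S.sClassOf T (S.atkinLehner r c) = S.sClassOf T c := by
  rw [S.sClassOf_eq_sClassOf_iff]
  exact Relation.ReflTransGen.single ⟨r, S.atkinLehner_atkinLehner r c⟩

/-- `[W_r c]_T = [c]_T` for `r ∈ T`, membership form. [cite: Martin2018, §4.1] -/
theorem XiSetup.sClassOf_atkinLehner_of_mem {r : ℕ} (hr : r ∈ T) (c : ClassSet S.O) :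
    S.sClassOf T (S.atkinLehner r c) = S.sClassOf T c :=
  S.sClassOf_atkinLehner T ⟨r, hr⟩ c

/-- `[Φ_T(g) c]_T = [c]_T`. [cite: Martin2018, §4.4] -/
theorem XiSetup.sClassOf_atkinLehnerHom (g : T → Multiplicative (ZMod 2)) (c : ClassSet S.O) :
    S.sClassOf T (S.atkinLehnerHom T g c) = S.sClassOf T c :=
  ((S.sClassOf_eq_sClassOf_iff_exists_atkinLehnerHom T c _).mpr ⟨g, rfl⟩).symm

/-- `Cl_T(O)` is finite. [cite: Martin2018, §2 ("The set `Cl_S(O)` is always finite")] -/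
theorem XiSetup.finite_sClassSet : Finite (S.SClassSet T) :=
  Quotient.finite (S.sClassSetoid T)

/-- `Cl_T(O)` is nonempty. [cite: Martin2018, §2] -/
theorem XiSetup.nonempty_sClassSet : Nonempty (S.SClassSet T) :=
  haveI := S.nonempty_classSet
  ⟨S.sClassOf T (Classical.arbitrary _)⟩

/-- **The type map factors through `Cl_T(O)`**: `T`-equivalent classes have the same type. [cite: Martin2018, §2 and §4.1 Lemma 4] -/
theorem XiSetup.typeOf_eq_of_sClassOf_eq {c c' : ClassSet S.O} (h : S.sClassOf T c = S.sClassOf T c') :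
    typeOf S.O c = typeOf S.O c' := by
  obtain ⟨g, rfl⟩ := (S.sClassOf_eq_sClassOf_iff_exists_atkinLehnerHom T c c').mp h
  rw [S.typeOf_atkinLehnerHom]

/-- There is a map `Cl_T(O) → Typ O` through which `typeOf` factors. [cite: Martin2018, §2] -/
theorem XiSetup.exists_typeOf_eq_comp_sClassOf : ∃ τ : S.SClassSet T → TypeSet S.O, typeOf S.O = τ ∘ S.sClassOf T :=
  ⟨fun X => Quotient.liftOn X (typeOf S.O) fun _ _ h => S.typeOf_eq_of_sClassOf_eq T (Quotient.sound h),
    funext fun _ => rfl⟩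

/-- **`t ≤ h_T`**: the type number is at most the `T`-class number. [cite: Martin2018, §2 (`h_B/2^{ω(𝔑)} ≤ t_B ≤ h_B`)] -/
theorem XiSetup.natCard_typeSet_le_natCard_sClassSet : Nat.card (TypeSet S.O) ≤ Nat.card (S.SClassSet T) := by
  haveI := S.finite_sClassSet T
  obtain ⟨τ, hτ⟩ := S.exists_typeOf_eq_comp_sClassOf T
  have hsurj : Function.Surjective τ := fun t => by
    obtain ⟨c, rfl⟩ := typeOf_surjective t
    exact ⟨S.sClassOf T c, by rw [hτ]; rfl⟩
  exact Nat.card_le_card_of_surjective τ hsurj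

/-- **`h_T ≤ h`**: the `T`-class number is at most the class number. [cite: Martin2018, §2] -/
theorem XiSetup.natCard_sClassSet_le_natCard_classSet : Nat.card (S.SClassSet T) ≤ Nat.card (ClassSet S.O) :=
  Nat.card_le_card_of_surjective _ (S.sClassOf_surjective T)

/-- `1 ≤ h_T`. [cite: Martin2018, §2] -/
theorem XiSetup.natCard_sClassSet_pos : 0 < Nat.card (S.SClassSet T) :=
  lt_of_lt_of_le S.natCard_typeSet_pos (S.natCard_typeSet_le_natCard_sClassSet T)

/-! ## §3 The two extreme cases: `Cl_∅(O) = Cls O` and `Cl_𝔑(O) = Typ O` -/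

/-- **If `T` contains no prime of `N⁺N⁻` (e.g. `T = ∅`), the `T`-classes are the classes**: `sClassOf` is injective.
[cite: Martin2018, §2 ("if `S = ∅` one gets (2.1)" `= Cl(O)`)] -/
theorem XiSetup.sClassOf_injective_of_forall_not_mem (hT : ∀ r ∈ T, r ∉ (Nplus * Nminus).primeFactors) :
    Function.Injective (S.sClassOf T) := by
  have hN0 : Nplus * Nminus ≠ 0 := mul_ne_zero S.nplus_ne_zero S.squarefree.ne_zero
  have hid : ∀ (r : T) (c : ClassSet S.O), S.atkinLehner r c = c := fun r c => by
    by_cases hd : (r : ℕ) ∣ Nplus * Nminus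
    · have hnp : ¬ (r : ℕ).Prime := fun hp => hT r r.2 (Nat.mem_primeFactors.mpr ⟨hp, hd, hN0⟩)
      rw [S.atkinLehner_of_not_prime hnp, id_eq]
    · exact S.atkinLehner_eq_self_of_not_dvd_mul hd c
  intro c c' h
  rw [S.sClassOf_eq_sClassOf_iff, S.sClassSetoid_iff] at h
  induction h with
  | refl => rfl
  | tail _ hbc ih => obtain ⟨r, rfl⟩ := hbc; rw [hid, ih]

/-- **`h_T = h` when `T` contains no prime of `N⁺N⁻`; in particular `h_∅ = h`.** [cite: Martin2018, §2] -/
theorem XiSetup.natCard_sClassSet_eq_natCard_classSet (hT : ∀ r ∈ T, r ∉ (Nplus * Nminus).primeFactors) :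
    Nat.card (S.SClassSet T) = Nat.card (ClassSet S.O) :=
  (Nat.card_eq_of_bijective _ ⟨S.sClassOf_injective_of_forall_not_mem T hT, S.sClassOf_surjective T⟩).symm

/-- `h_∅ = h`. [cite: Martin2018, §2] -/
theorem XiSetup.natCard_sClassSet_empty : Nat.card (S.SClassSet ∅) = Nat.card (ClassSet S.O) :=
  S.natCard_sClassSet_eq_natCard_classSet ∅ fun _ h => absurd h (Finset.notMem_empty _)

/-- **If `T` contains every prime of `N⁺N⁻`, then `c ∼_T c'` iff `c, c'` have the same type** (the fibres of the type map
are the orbits of all the involutions, `EichlerOrdersTypeFibres`). [cite: Martin2018, §2 ("if `S = {𝔭 : 𝔭 ∣ 𝔑}` one gets (2.2)", the conjugacy classes of orders)] [cite: Voight2021, Prop. 18.5.10 and (23.4.20)] -/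
theorem XiSetup.sClassSetoid_iff_typeOf_eq (hT : (Nplus * Nminus).primeFactors ⊆ T) (c c' : ClassSet S.O) :
    S.sClassSetoid T c c' ↔ typeOf S.O c = typeOf S.O c' := by
  constructor
  · intro h
    exact S.typeOf_eq_of_sClassOf_eq T ((S.sClassOf_eq_sClassOf_iff T c c').mpr h)
  · intro h
    have hN0 : Nplus * Nminus ≠ 0 := mul_ne_zero S.nplus_ne_zero S.squarefree.ne_zero
    have key : ∀ c', Relation.ReflTransGen
        (fun a b : ClassSet S.O =>
          (∃ (q : ℕ) (_ : Fact q.Prime) (hq : q ∣ Nminus), S.wMinus q hq a = b) ∨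
            (∃ (p : ℕ) (_ : Fact p.Prime) (hp : ¬ p ∣ Nminus), S.wPlus p hp a = b)) c c' →
        Relation.ReflTransGen (fun a b => ∃ r : T, S.atkinLehner r a = b) c c' := by
      intro c' hreach
      induction hreach with
      | refl => exact Relation.ReflTransGen.refl
      | tail _ hbc ih =>
        rcases hbc with ⟨q, hf, hq, rfl⟩ | ⟨p, hf, hp, rfl⟩
        · have hm : q ∈ T := hT (Nat.mem_primeFactors.mpr ⟨hf.out, hq.mul_left Nplus, hN0⟩)
          exact ih.tail ⟨⟨q, hm⟩, by rw [S.atkinLehner_of_dvd hq]⟩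
        · by_cases hpN : p ∣ Nplus
          · have hm : p ∈ T := hT (Nat.mem_primeFactors.mpr ⟨hf.out, hpN.mul_right Nminus, hN0⟩)
            exact ih.tail ⟨⟨p, hm⟩, by rw [S.atkinLehner_of_not_dvd hp]⟩
          · rw [S.wPlus_eq_self_of_not_dvd hp hpN]
            exact ih
    rw [S.sClassSetoid_iff]
    exact key c' (S.typeOf_eq_typeOf_iff_reflTransGen_atkinLehner.mp h.symm)

/-- `sClassOf c = sClassOf c'` iff same type, when `T ⊇` primes of `N⁺N⁻`. [cite: Martin2018, §2] [cite: Voight2021, (23.4.20)] -/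
theorem XiSetup.sClassOf_eq_sClassOf_iff_typeOf_eq (hT : (Nplus * Nminus).primeFactors ⊆ T) (c c' : ClassSet S.O) :
    S.sClassOf T c = S.sClassOf T c' ↔ typeOf S.O c = typeOf S.O c' := by
  rw [S.sClassOf_eq_sClassOf_iff, S.sClassSetoid_iff_typeOf_eq T hT]

/-- **`Cl_T(O) ≃ Typ O` when `T` contains every prime of `N⁺N⁻`** (an equivalence compatible with the projections).
[cite: Martin2018, §2] [cite: Voight2021, Prop. 18.5.10] -/
theorem XiSetup.exists_equiv_sClassSet_typeSet (hT : (Nplus * Nminus).primeFactors ⊆ T) :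
    ∃ e : S.SClassSet T ≃ TypeSet S.O, ∀ c, e (S.sClassOf T c) = typeOf S.O c :=
  ⟨Quotient.congrRight fun a b => (S.sClassSetoid_iff_typeOf_eq T hT a b).trans typeOf_eq_typeOf_iff, fun _ => rfl⟩

/-- **`h_T = t` (the type number) when `T` contains every prime of `N⁺N⁻`.** [cite: Martin2018, §2 (`h_{B,𝔑} = t_B`)] [cite: Voight2021, Cor. 18.5.12] -/
theorem XiSetup.natCard_sClassSet_eq_natCard_typeSet (hT : (Nplus * Nminus).primeFactors ⊆ T) :
    Nat.card (S.SClassSet T) = Nat.card (TypeSet S.O) := by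
  obtain ⟨e, -⟩ := S.exists_equiv_sClassSet_typeSet T hT
  exact Nat.card_congr e

/-! ## §4 `M^{+_T}(O)` is the space of functions on `Cl_T(O)`: `h_T = dim M^{+_T}(O)` (Martin (3.8)–(3.9)) -/

/-- **`φ ∈ M^{+_T}(O)` iff `φ` is constant on `T`-classes**, `φ = g ∘ sClassOf` (Martin (3.8): "we can view forms in
`M_k^{+_𝔐}(O)` as certain functions on `Cl_S(O)` … `M_0^{+_𝔐}(O) ≃ {φ : Cl_𝔐(O) → ℂ}`"). [cite: Martin2018, §3.3 (3.8)] -/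
theorem XiSetup.mem_signSpace_one_iff_exists_comp_sClassOf (v : ClassSet S.O → ℚ) :
    v ∈ S.signSpace T 1 ↔ ∃ g : S.SClassSet T → ℚ, v = g ∘ S.sClassOf T := by
  rw [S.mem_signSpace_iff]
  simp only [Pi.one_apply, Units.val_one, Int.cast_one, one_mul]
  constructor
  · intro h
    have hconst : ∀ c c' : ClassSet S.O, S.sClassSetoid T c c' → v c = v c' := by
      intro c c' hcc'
      rw [S.sClassSetoid_iff] at hcc'
      induction hcc' with
      | refl => rfl
      | tail _ hbc ih => obtain ⟨r, rfl⟩ := hbc; rw [h, ih]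
    refine ⟨fun X => Quotient.liftOn X v fun c c' hcc' => hconst c c' hcc', funext fun c => ?_⟩
    rfl
  · rintro ⟨g, rfl⟩ r c
    exact congrArg g (S.sClassOf_atkinLehner T r c)

/-- **`M^{+_T}(O)` = the pull-backs of the functions on `Cl_T(O)`** (as a submodule of `ℚ^{Cls O}`). [cite: Martin2018, §3.3 (3.8)] -/
theorem XiSetup.signSpace_one_eq_range_funLeft_sClassOf :
    S.signSpace T 1 = LinearMap.range (LinearMap.funLeft ℚ ℚ (S.sClassOf T)) := by
  ext v
  rw [S.mem_signSpace_one_iff_exists_comp_sClassOf, LinearMap.mem_range]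
  constructor
  · rintro ⟨g, rfl⟩; exact ⟨g, rfl⟩
  · rintro ⟨g, rfl⟩; exact ⟨g, rfl⟩

/-- `g ↦ g ∘ sClassOf` is injective (`sClassOf` is onto). [cite: Martin2018, §3.3 (3.8)] -/
theorem XiSetup.funLeft_sClassOf_injective : Function.Injective (LinearMap.funLeft ℚ ℚ (S.sClassOf T)) :=
  LinearMap.funLeft_injective_of_surjective _ _ _ (S.sClassOf_surjective T)

/-- **MARTIN'S (3.9): `dim M^{+_T}(O) = h_T = #Cl_T(O)`** for every Eichler order of a definite quaternion algebra over `ℚ`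
and every finite `T` ("`h_{B,𝔐} = dim M_0^{+_𝔐}(O)`"). [cite: Martin2018, §3.3 (3.9)] -/
theorem XiSetup.finrank_signSpace_one_eq_natCard_sClassSet :
    Module.finrank ℚ (S.signSpace T 1) = Nat.card (S.SClassSet T) := by
  haveI := S.finite_sClassSet T
  letI : Fintype (S.SClassSet T) := Fintype.ofFinite _
  rw [S.signSpace_one_eq_range_funLeft_sClassOf, LinearMap.finrank_range_of_inj (S.funLeft_sClassOf_injective T),
    Module.finrank_fintype_fun_eq_card, Nat.card_eq_fintype_card]

/-- **`∑_{χ ≠ +_T} dim M^χ(O) = h − h_T`.** [cite: Martin2018, §3.3 (3.9) and §4.3] -/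
theorem XiSetup.sum_finrank_signSpace_ne_one_eq :
    ∑ χ ∈ (Finset.univ : Finset (T → ℤˣ)).erase 1, Module.finrank ℚ (S.signSpace T χ) =
      Nat.card (ClassSet S.O) - Nat.card (S.SClassSet T) := by
  classical
  have h := S.sum_finrank_signSpace T
  rw [← Finset.add_sum_erase _ _ (Finset.mem_univ (1 : T → ℤˣ)), S.finrank_signSpace_one_eq_natCard_sClassSet T] at h
  omega

/-- The functions on `Cl_T(O)` form a Hecke submodule of `ℚ^{Cls O}`. [cite: Martin2018, §3.3] [cite: Voight2021, Cor. 41.4.10] -/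
theorem XiSetup.mapsTo_toLin_matrix_range_funLeft_sClassOf [Fintype (ClassSet S.O)] [DecidableEq (ClassSet S.O)] (n : ℕ) :
    Set.MapsTo (Matrix.toLin' ((matrix S.O n).map (Int.cast : ℤ → ℚ)))
      (LinearMap.range (LinearMap.funLeft ℚ ℚ (S.sClassOf T))) (LinearMap.range (LinearMap.funLeft ℚ ℚ (S.sClassOf T))) := by
  rw [← S.signSpace_one_eq_range_funLeft_sClassOf]
  exact S.mapsTo_toLin_matrix_signSpace T 1 n

/-! ## §5 Changing `T`: monotonicity and Martin's Lemma 9 -/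

/-- Enlarging `T` coarsens the classes. [cite: Martin2018, §4.4 (proof of Lemma 9: "the projection `Cl_{𝔐₀}(O) → Cl_𝔐(O)`")] -/
theorem XiSetup.sClassSetoid_mono {T T' : Finset ℕ} (h : T ⊆ T') {c c' : ClassSet S.O} (hcc' : S.sClassSetoid T c c') :
    S.sClassSetoid T' c c' := by
  rw [S.sClassSetoid_iff] at hcc' ⊢
  have hmono : ∀ a b, (∃ r : T, S.atkinLehner r a = b) → ∃ r : T', S.atkinLehner r a = b := fun a b hab => by
    obtain ⟨r, hr⟩ := hab
    exact ⟨⟨r, h r.2⟩, hr⟩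
  exact Relation.ReflTransGen.mono hmono _ _ hcc'

/-- The projection `Cl_T(O) → Cl_{T'}(O)` for `T ⊆ T'`: `sClassOf T'` factors through `sClassOf T`. [cite: Martin2018, §4.4 (proof of Lemma 9)] -/
theorem XiSetup.exists_sClassOf_eq_comp {T T' : Finset ℕ} (h : T ⊆ T') :
    ∃ π : S.SClassSet T → S.SClassSet T', S.sClassOf T' = π ∘ S.sClassOf T ∧ Function.Surjective π := by
  refine ⟨fun X => Quotient.liftOn X (S.sClassOf T') fun c c' hcc' =>
      (S.sClassOf_eq_sClassOf_iff T' c c').mpr (S.sClassSetoid_mono h hcc'), funext fun _ => rfl, fun Y => ?_⟩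
  obtain ⟨c, rfl⟩ := S.sClassOf_surjective T' Y
  exact ⟨S.sClassOf T c, rfl⟩

/-- **`h_{T'} ≤ h_T` for `T ⊆ T'`.** [cite: Martin2018, §2 and §4.4] -/
theorem XiSetup.natCard_sClassSet_anti {T T' : Finset ℕ} (h : T ⊆ T') : Nat.card (S.SClassSet T') ≤ Nat.card (S.SClassSet T) := by
  haveI := S.finite_sClassSet T
  obtain ⟨π, -, hπ⟩ := S.exists_sClassOf_eq_comp h
  exact Nat.card_le_card_of_surjective π hπ

/-- **MARTIN'S LEMMA 9: `W_r` maps `T`-classes to `T`-classes** — `c ∼_T c' ⇒ W_r c ∼_T W_r c'`, for every `r` (in `T` or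
not; the involutions commute). [cite: Martin2018, §4.4 Lemma 9] -/
theorem XiSetup.sClassSetoid_atkinLehner (r : ℕ) {c c' : ClassSet S.O} (h : S.sClassSetoid T c c') :
    S.sClassSetoid T (S.atkinLehner r c) (S.atkinLehner r c') := by
  rw [S.sClassSetoid_iff] at h ⊢
  induction h with
  | refl => exact Relation.ReflTransGen.refl
  | tail _ hbc ih =>
    obtain ⟨r', rfl⟩ := hbc
    exact ih.tail ⟨r', by rw [S.atkinLehner_comm]⟩

/-- Lemma 9 on the quotient: `[W_r c]_T` depends only on `[c]_T`. [cite: Martin2018, §4.4 Lemma 9] -/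
theorem XiSetup.sClassOf_atkinLehner_eq_of_sClassOf_eq (r : ℕ) {c c' : ClassSet S.O} (h : S.sClassOf T c = S.sClassOf T c') :
    S.sClassOf T (S.atkinLehner r c) = S.sClassOf T (S.atkinLehner r c') :=
  (S.sClassOf_eq_sClassOf_iff T _ _).mpr (S.sClassSetoid_atkinLehner T r ((S.sClassOf_eq_sClassOf_iff T c c').mp h))

/-- **A `(T ∪ {r})`-class is a `T`-class or the union of a `T`-class with its `W_r`-image** ("the projection
`Cl_{𝔐₀}(O) → Cl_𝔐(O)` has fibers of size 1 or 2"): `c ∼_{T ∪ {r}} c'` iff `c ∼_T c'` or `W_r c ∼_T c'`. [cite: Martin2018, §4.1 and §4.4 (proof of Lemma 9)] -/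
theorem XiSetup.sClassSetoid_insert_iff (r : ℕ) (c c' : ClassSet S.O) :
    S.sClassSetoid (insert r T) c c' ↔ S.sClassSetoid T c c' ∨ S.sClassSetoid T (S.atkinLehner r c) c' := by
  classical
  constructor
  · intro h
    rw [S.sClassSetoid_iff] at h
    induction h with
    | refl => exact Or.inl ((S.sClassSetoid T).refl' _)
    | tail _ hbc ih =>
      obtain ⟨⟨r', hr'⟩, rfl⟩ := hbc
      rcases Finset.mem_insert.mp hr' with rfl | hr'T
      · -- a `W_r`-step: swap the two alternatives
        rcases ih with h1 | h2
        · right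
          have := S.sClassSetoid_atkinLehner T r' h1
          exact this
        · left
          have := S.sClassSetoid_atkinLehner T r' h2
          rwa [S.atkinLehner_atkinLehner] at this
      · rcases ih with h1 | h2
        · exact Or.inl (h1.tail ⟨⟨r', hr'T⟩, rfl⟩)
        · exact Or.inr (h2.tail ⟨⟨r', hr'T⟩, rfl⟩)
  · rintro (h | h)
    · exact S.sClassSetoid_mono (Finset.subset_insert r T) h
    · have step : S.sClassSetoid (insert r T) c (S.atkinLehner r c) :=
        Relation.ReflTransGen.single ⟨⟨r, Finset.mem_insert_self r T⟩, rfl⟩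
      exact (S.sClassSetoid (insert r T)).trans' step (S.sClassSetoid_mono (Finset.subset_insert r T) h)

/-- **`h_T ≤ 2 · h_{T ∪ {r}}`**: each fibre of `Cl_T(O) → Cl_{T ∪ {r}}(O)` has at most two elements. [cite: Martin2018, §4.1 ("fibers of size 1 or 2") and §4.4] -/
theorem XiSetup.natCard_sClassSet_le_two_mul_natCard_sClassSet_insert (r : ℕ) :
    Nat.card (S.SClassSet T) ≤ 2 * Nat.card (S.SClassSet (insert r T)) := by
  classical
  haveI := S.finite_sClassSet T
  haveI := S.finite_sClassSet (insert r T)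
  -- the map `Cl_{T∪{r}}(O) × Bool → Cl_T(O)`, `([c], b) ↦ [c]_T` or `[W_r c]_T`, is onto
  obtain ⟨π, hπ, -⟩ := S.exists_sClassOf_eq_comp (Finset.subset_insert r T)
  -- choose a representative of each `(T ∪ {r})`-class
  let ρ : S.SClassSet (insert r T) → ClassSet S.O := fun Y => (S.sClassOf_surjective (insert r T) Y).choose
  have hρ : ∀ Y, S.sClassOf (insert r T) (ρ Y) = Y := fun Y => (S.sClassOf_surjective (insert r T) Y).choose_spec
  let f : S.SClassSet (insert r T) × Bool → S.SClassSet T := fun Yb =>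
    cond Yb.2 (S.sClassOf T (ρ Yb.1)) (S.sClassOf T (S.atkinLehner r (ρ Yb.1)))
  have hf : Function.Surjective f := by
    intro X
    obtain ⟨c, rfl⟩ := S.sClassOf_surjective T X
    set Y := S.sClassOf (insert r T) c with hY
    have hrel : S.sClassSetoid (insert r T) (ρ Y) c :=
      (S.sClassOf_eq_sClassOf_iff _ _ _).mp (by rw [hρ Y])
    rcases (S.sClassSetoid_insert_iff T r (ρ Y) c).mp hrel with h1 | h2
    · exact ⟨(Y, true), (S.sClassOf_eq_sClassOf_iff T _ _).mpr h1⟩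
    · exact ⟨(Y, false), (S.sClassOf_eq_sClassOf_iff T _ _).mpr h2⟩
  have key := Nat.card_le_card_of_surjective f hf
  rw [Nat.card_prod, Nat.card_eq_fintype_card (α := Bool), Fintype.card_bool] at key
  linarith

/-! ## §6 Orbit–stabiliser and Burnside for the sign group: class sizes are powers of two -/

/-- The `T`-class of `c` as a subtype is the `Φ_T`-orbit of `c`. [cite: Martin2018, §4.4] -/
theorem XiSetup.mem_sClass_iff_exists_atkinLehnerHom (c c' : ClassSet S.O) :
    S.sClassOf T c' = S.sClassOf T c ↔ ∃ g, S.atkinLehnerHom T g c = c' := by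
  rw [eq_comm, S.sClassOf_eq_sClassOf_iff_exists_atkinLehnerHom]

/-- **ORBIT–STABILISER: `#X_i · #Stab(c) = 2^{#T}`** for the `T`-class `X_i` of `c` and its stabiliser in `(ℤ/2ℤ)^T`.
[cite: Martin2018, §4.4 (remark after Lemma 9)] [cite: Voight2021, Prop. 18.5.10] -/
theorem XiSetup.natCard_sClass_mul_natCard_stabilizer (c : ClassSet S.O) :
    Nat.card {c' : ClassSet S.O // S.sClassOf T c' = S.sClassOf T c} *
        Nat.card {g : T → Multiplicative (ZMod 2) // S.atkinLehnerHom T g c = c} = 2 ^ T.card := by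
  classical
  haveI : Fintype (ClassSet S.O) := Fintype.ofFinite _
  letI : MulAction (T → Multiplicative (ZMod 2)) (ClassSet S.O) := MulAction.compHom _ (S.atkinLehnerHom T)
  have hsmul : ∀ (g : T → Multiplicative (ZMod 2)) (x : ClassSet S.O), g • x = S.atkinLehnerHom T g x := fun _ _ => rfl
  have h1 : Nat.card {c' : ClassSet S.O // S.sClassOf T c' = S.sClassOf T c} =
      Fintype.card (MulAction.orbit (T → Multiplicative (ZMod 2)) c) := by
    rw [Nat.card_eq_fintype_card]
    refine Fintype.card_congr (Equiv.subtypeEquivRight fun c' => ?_)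
    rw [S.mem_sClass_iff_exists_atkinLehnerHom, MulAction.mem_orbit_iff]
    simp only [hsmul]
  have h2 : Nat.card {g : T → Multiplicative (ZMod 2) // S.atkinLehnerHom T g c = c} =
      Fintype.card (MulAction.stabilizer (T → Multiplicative (ZMod 2)) c) := by
    rw [Nat.card_eq_fintype_card]
    refine Fintype.card_congr (Equiv.subtypeEquivRight fun g => ?_)
    rw [MulAction.mem_stabilizer_iff, hsmul]
  have hG : Fintype.card (T → Multiplicative (ZMod 2)) = 2 ^ T.card := by
    rw [Fintype.card_fun, Fintype.card_multiplicative, ZMod.card, Fintype.card_coe]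
  rw [h1, h2, MulAction.card_orbit_mul_card_stabilizer_eq_card_group, hG]

/-- **"EACH CONNECTED COMPONENT `X_i` HAS CARDINALITY `2^m`"** (Martin, after Lemma 9), with `m ≤ #T`: every `T`-class has
`2^m` elements. [cite: Martin2018, §4.4 (remark after Lemma 9)] -/
theorem XiSetup.exists_natCard_sClass_eq_two_pow (c : ClassSet S.O) :
    ∃ m ≤ T.card, Nat.card {c' : ClassSet S.O // S.sClassOf T c' = S.sClassOf T c} = 2 ^ m := by
  have h := S.natCard_sClass_mul_natCard_stabilizer T c
  have hdvd : Nat.card {c' : ClassSet S.O // S.sClassOf T c' = S.sClassOf T c} ∣ 2 ^ T.card :=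
    Dvd.intro _ h
  obtain ⟨m, hm, hmeq⟩ := (Nat.dvd_prime_pow Nat.prime_two).mp hdvd
  exact ⟨m, hm, hmeq⟩

/-- Every `T`-class has at most `2^{#T}` elements. [cite: Martin2018, §4.4] [cite: Voight2021, Cor. 18.5.12] -/
theorem XiSetup.natCard_sClass_le_two_pow (c : ClassSet S.O) :
    Nat.card {c' : ClassSet S.O // S.sClassOf T c' = S.sClassOf T c} ≤ 2 ^ T.card := by
  have h := S.natCard_sClass_mul_natCard_stabilizer T c
  have hpos : 0 < Nat.card {g : T → Multiplicative (ZMod 2) // S.atkinLehnerHom T g c = c} := by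
    haveI : Finite {g : T → Multiplicative (ZMod 2) // S.atkinLehnerHom T g c = c} := inferInstance
    haveI : Nonempty {g : T → Multiplicative (ZMod 2) // S.atkinLehnerHom T g c = c} :=
      ⟨⟨1, by rw [map_one, Equiv.Perm.coe_one, id_eq]⟩⟩
    exact Nat.card_pos
  nlinarith

/-- **BURNSIDE: `∑_{g ∈ (ℤ/2ℤ)^T} #Fix(Φ_T g) = 2^{#T} · h_T`.** [cite: Martin2018, §4.4] [cite: Voight2021, Cor. 18.5.12] -/
theorem XiSetup.sum_natCard_fixedPoints_atkinLehnerHom [Fintype (ClassSet S.O)] :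
    ∑ g : T → Multiplicative (ZMod 2), Nat.card {c : ClassSet S.O // S.atkinLehnerHom T g c = c} =
      2 ^ T.card * Nat.card (S.SClassSet T) := by
  classical
  letI : MulAction (T → Multiplicative (ZMod 2)) (ClassSet S.O) := MulAction.compHom _ (S.atkinLehnerHom T)
  have hsmul : ∀ (g : T → Multiplicative (ZMod 2)) (x : ClassSet S.O), g • x = S.atkinLehnerHom T g x := fun _ _ => rfl
  have burnside := MulAction.sum_card_fixedBy_eq_card_orbits_mul_card_group (T → Multiplicative (ZMod 2)) (ClassSet S.O)
  have hG : Fintype.card (T → Multiplicative (ZMod 2)) = 2 ^ T.card := by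
    rw [Fintype.card_fun, Fintype.card_multiplicative, ZMod.card, Fintype.card_coe]
  have hrel : ∀ a b : ClassSet S.O,
      (MulAction.orbitRel (T → Multiplicative (ZMod 2)) (ClassSet S.O)) a b ↔ S.sClassSetoid T a b := by
    intro a b
    rw [MulAction.orbitRel_apply, MulAction.mem_orbit_iff, S.sClassSetoid_iff_exists_atkinLehnerHom]
    simp only [hsmul]
    constructor
    · rintro ⟨g, hg⟩; exact ⟨g, by rw [← hg, S.atkinLehnerHom_atkinLehnerHom]⟩
    · rintro ⟨g, hg⟩; exact ⟨g, by rw [← hg, S.atkinLehnerHom_atkinLehnerHom]⟩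
  have hΩ : Fintype.card (Quotient (MulAction.orbitRel (T → Multiplicative (ZMod 2)) (ClassSet S.O))) =
      Nat.card (S.SClassSet T) := by
    haveI := S.finite_sClassSet T
    letI : Fintype (S.SClassSet T) := Fintype.ofFinite _
    rw [Nat.card_eq_fintype_card]
    exact Fintype.card_congr (Quotient.congrRight fun a b => hrel a b)
  have hfix : ∀ g : T → Multiplicative (ZMod 2),
      Fintype.card (MulAction.fixedBy (ClassSet S.O) g) = Nat.card {c : ClassSet S.O // S.atkinLehnerHom T g c = c} :=
    fun g => by
    rw [Nat.card_eq_fintype_card]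
    exact Fintype.card_congr (Equiv.subtypeEquivRight fun c => by rw [MulAction.mem_fixedBy, hsmul])
  calc ∑ g : T → Multiplicative (ZMod 2), Nat.card {c : ClassSet S.O // S.atkinLehnerHom T g c = c}
      = ∑ g : T → Multiplicative (ZMod 2), Fintype.card (MulAction.fixedBy (ClassSet S.O) g) :=
        Finset.sum_congr rfl fun g _ => (hfix g).symm
    _ = 2 ^ T.card * Nat.card (S.SClassSet T) := by rw [burnside, hΩ, hG, mul_comm]

/-- **`h ≤ 2^{#T} · h_T`** (Martin: `h_B / 2^{ω(𝔑)} ≤ t_B`; every `T`-class has at most `2^{#T}` members).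
[cite: Martin2018, §2 and §4.4] [cite: Voight2021, Cor. 18.5.12] -/
theorem XiSetup.natCard_classSet_le_two_pow_mul_natCard_sClassSet :
    Nat.card (ClassSet S.O) ≤ 2 ^ T.card * Nat.card (S.SClassSet T) := by
  classical
  haveI : Fintype (ClassSet S.O) := Fintype.ofFinite _
  rw [← S.sum_natCard_fixedPoints_atkinLehnerHom T]
  have h1 : Nat.card {c : ClassSet S.O // S.atkinLehnerHom T 1 c = c} = Nat.card (ClassSet S.O) :=
    Nat.card_congr (Equiv.subtypeUnivEquiv fun c => by rw [map_one, Equiv.Perm.coe_one, id_eq])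
  rw [← h1]
  exact Finset.single_le_sum (f := fun g => Nat.card {c : ClassSet S.O // S.atkinLehnerHom T g c = c})
    (fun _ _ => Nat.zero_le _) (Finset.mem_univ _)

/-- **`h ≤ 2^{#T} · dim M^{+_T}(O)`** (the same bound through Martin's (3.9)). [cite: Martin2018, §2 and (3.9)] -/
theorem XiSetup.natCard_classSet_le_two_pow_mul_finrank_signSpace_one :
    Nat.card (ClassSet S.O) ≤ 2 ^ T.card * Module.finrank ℚ (S.signSpace T 1) := by
  rw [S.finrank_signSpace_one_eq_natCard_sClassSet]
  exact S.natCard_classSet_le_two_pow_mul_natCard_sClassSet T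

end Brandt

end Literature.NumberTheory.Automorphic
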